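import Literature.AlgebraicGeometry.ComplexMultiplication.QuarticCMTypeReflectionConjugationSquare
import Literature.AlgebraicGeometry.ComplexMultiplication.CMFamilyRankClosureBound
import Literature.AlgebraicGeometry.ComplexMultiplication.ImaginaryQuadraticTimesQuarticCMHodge
import Literature.AlgebraicGeometry.ComplexMultiplication.SmallIntersectionCMFieldsHodge
import Literature.NumberTheory.ComplexMultiplication.PartialConjugationOfConjSqrt
import HarnessLib

/-!
# Pairs of quartic CM fields, I: a non-Galois quartic CM field and a non-isomorphic quartic CM field with the SAME Galois
# closure carry only nondegenerate pairs of CM types; conjugation fixes `L₀ ∩ L₁` pointwise for DIFFERENT Galois closures;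
# every CM type of a quartic CM field that is not biquadratic is nondegenerate

(Part 1) The combinatorial core for two quartic slots with a `4`-cycle `τ` (`a ↦ b ↦ ā ↦ b̄`) and the reflection `τ₀` on the
first field, transported to the second field through the common Galois closure: if `σ ∈ Aut(ℂ)` fixes one embedding of the
non-Galois quartic `K_{i₀}` and moves another while fixing an embedding of `K_{i₁} ⊂ L_{i₀}`, then `K_{i₀} ≅ K_{i₁}`;
hence NON-ISOMORPHIC quartic CM fields with `L₀ = L₁` carry only NONDEGENERATE pairs of CM types
(`isNondegenerateFamily_pair_of_normalClosure_eq_of_isEmpty`: a simple CM abelian surface and a surface with CM by the reflex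
field). (Part 2) For a quartic CM field which is not biquadratic (cyclic Galois, or non-Galois) every normal subfield
`M ⊊ L` of the Galois closure is fixed pointwise by complex conjugation (`conj_apply_eq_of_ne_normalClosure_quartic`), so for two
such fields with different Galois closures conjugation fixes `L₀ ∩ L₁` (`conj_apply_eq_of_mem_inf_of_normalClosure_ne`); a
primitive quartic type lives on a non-biquadratic field and every CM type of a non-biquadratic quartic CM field is
nondegenerate (`isNondegenerate_of_quartic_not_biquadratic`, Ribet's bound in degree `≤ 6`).

* Part 1 — from `CorCM/QuarticCMReflexPairHodge` (7/9 declarations; namespace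
  `Literature.AlgebraicGeometry.ComplexMultiplication`): A simple CM abelian surface and a surface with CM by the
  REFLEX field: the pair is nondegenerate. Declarations: `sum_eq_add_two`,
  `isNondegenerateFamily_pair_of_reflection_free`, `smul_eq_smul_of_forall_smul_eq`, `finiteDimensional_of_le₉`,
  `nonempty_ringEquiv_of_smul_eq_self`, `isNondegenerateFamily_pair_of_same_closure_of_isEmpty`,
  `isNondegenerateFamily_pair_of_normalClosure_eq_of_isEmpty`.
* Part 2 — from `CorCM/SimpleCMSurfacePairsHodge` (8/12 declarations; namespace
  `Literature.AlgebraicGeometry.ComplexMultiplication`): Two simple CM abelian surfaces with DIFFERENT Galois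
  closures: the Hodge conjecture for every `S₀^a × S₁^b` —. Declarations: `finiteDimensional_of_le₈`,
  `ringEquiv_apply_algebraMap₈`, `conj_apply_eq_of_ne_normalClosure_of_not_isGalois`,
  `conj_apply_eq_of_ne_normalClosure_of_isCyclic`, `conj_apply_eq_of_ne_normalClosure_quartic`,
  `conj_apply_eq_of_mem_inf_of_normalClosure_ne`, `not_biquadratic_of_isPrimitive`,
  `isNondegenerate_of_quartic_not_biquadratic`.

## References

* [MoonenZarhin1999LowDim] B. Moonen, Yu. Zarhin, Math. Ann. 315 (1999), "Hodge groups of simple abelian surfaces of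
  CM-type" and Cor. (3.9).
* [Shimura1998] G. Shimura, *Abelian Varieties with Complex Multiplication and Modular Functions*, §8.4 Example
  (2)(C).
* [Gordon1999HodgeAVSurvey] B. B. Gordon, *A survey of the Hodge conjecture for abelian varieties*, 7.5, §9.2–9.3,
  10.10.
* [Lang2002] S. Lang, *Algebra*, 3rd ed., VI §1 Thm. 1.1, Cor. 1.4; I §6 (groups of order `p²`).

Provenance: Literature home of the used declarations of the Summits-side modules listed part by part above (cells
`pub-hodge-ring2` / `pub-hodgecm2`; namespaces `Summit.HodgeConjecture.CorCM` re-rooted under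
`Literature.AlgebraicGeometry.…` as stated), whose imports are `Literature/` and Mathlib only for the declarations
used; re-homed verbatim (proofs unchanged) so that Literature users are served without importing `Summits/`. Lane
`lit-hodgefound`, seat p20 (generation 34). Theorems only: no definition, no named fact, no `sorry`; axioms `propext`,
`Classical.choice`, `Quot.sound`.
-/

/-! ## Part 1: QuarticCMReflexPairHodge -/

noncomputable section

open _root_.CategoryTheory _root_.CategoryTheory.Limits NumberField NumberField.ComplexEmbedding IntermediateField Module

namespace Literature.AlgebraicGeometry.ComplexMultiplication

open Literature.AlgebraicGeometry.ComplexMultiplication.Domination Literature.AlgebraicGeometry.ComplexMultiplication.RankClosureBound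

open Literature.NumberTheory.ComplexMultiplication
open Literature.NumberTheory.ComplexMultiplication.CMTypeOps (mem_iff_conjugate_notMem)
open Literature.AlgebraicGeometry.Motives (AbelianVariety CMType)
open Literature.AlgebraicGeometry.HodgeTheory
open Literature.AlgebraicGeometry.Pohlmann1968

section Core

variable {I : Type} {K : I → Type} [∀ i, Field (K i)] [∀ i, NumberField (K i)] [∀ i, IsCMField (K i)] [Fintype I]

omit [∀ i, NumberField (K i)] [∀ i, IsCMField (K i)] [Fintype I] in
/-- `Σ_i G(i) = G(i₀) + G(i₁)` on a two-slot index type. [cite: MoonenZarhin1999LowDim, "Hodge groups of simple abelian surfaces of CM-type"] -/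
private theorem sum_eq_add_two {M : Type*} [AddCommMonoid M] [Fintype I] {i₀ i₁ : I} (h01 : i₀ ≠ i₁)
    (hI : ∀ j, j = i₀ ∨ j = i₁) (G : I → M) : ∑ i, G i = G i₀ + G i₁ := by
  classical
  have huniv : (Finset.univ : Finset I) = {i₀, i₁} := by
    ext j
    simpa using hI j
  rw [huniv, Finset.sum_pair h01]

/-- **The combinatorial core**: two quartic slots; `τ` a `4`-cycle `a ↦ b ↦ ā ↦ b̄` and `τ₀` the reflection fixing
`a, ā` on the first; `τ²c = c̄`, `τ₀τc = τ³τ₀c`, `τ₀c ∈ {τ³c, τc}` (no fixed point) on the second; types `{a, b}`,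
`{c, τc}`: the eight balance identities force conjugation-invariance, the family is nondegenerate.
[cite: MoonenZarhin1999LowDim, "Hodge groups of simple abelian surfaces of CM-type"] [cite: Gordon1999HodgeAVSurvey, §9.2–9.3] -/
theorem isNondegenerateFamily_pair_of_reflection_free {i₀ i₁ : I} (h01 : i₀ ≠ i₁) (hI : ∀ j, j = i₀ ∨ j = i₁)
    (h4₀ : finrank ℚ (K i₀) = 4) (h4₁ : finrank ℚ (K i₁) = 4) {a b : K i₀ →+* ℂ} (hba : b ≠ a)
    (hba' : b ≠ conjugate a) {c : K i₁ →+* ℂ} {τ τ₀ : ℂ ≃+* ℂ} (hτa : τ • a = b) (hτb : τ • b = conjugate a)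
    (hτ₀a : τ₀ • a = a) (hτ₀b : τ₀ • b = conjugate b) (hτc : τ • τ • c = conjugate c)
    (hτ₀τc : τ₀ • τ • c = τ • τ • τ • τ₀ • c) (hτ₀c : τ₀ • c = τ • τ • τ • c ∨ τ₀ • c = τ • c)
    {Φ : ∀ i, CMType (K i)} (hΦ₀ : ∀ s, s ∈ (Φ i₀).1 ↔ s = a ∨ s = b)
    (hΦ₁ : ∀ s, s ∈ (Φ i₁).1 ↔ s = c ∨ s = τ • c) : CMAlgebra.IsNondegenerateFamily Φ := by
  classical
  haveI : Nonempty I := ⟨i₀⟩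
  -- first slot: the four embeddings and the tables
  have hab' : conjugate b ≠ a := fun h => hba' (by rw [← h, involutive_conjugate (K i₀) b])
  have hτa' : τ • conjugate a = conjugate b := by rw [QuarticCM.smul_conjugate, hτa]
  have hτb' : τ • conjugate b = a := by rw [QuarticCM.smul_conjugate, hτb, involutive_conjugate (K i₀) a]
  have hτ₀a' : τ₀ • conjugate a = conjugate a := by rw [QuarticCM.smul_conjugate, hτ₀a]
  have hτ₀b' : τ₀ • conjugate b = b := by rw [QuarticCM.smul_conjugate, hτ₀b, involutive_conjugate (K i₀) b]
  have hΦa : a ∈ (Φ i₀).1 := (hΦ₀ a).2 (Or.inl rfl); have hΦb : b ∈ (Φ i₀).1 := (hΦ₀ b).2 (Or.inr rfl)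
  have hΦna : conjugate a ∉ (Φ i₀).1 := (mem_iff_conjugate_notMem (Φ i₀) a).1 hΦa
  have hΦnb : conjugate b ∉ (Φ i₀).1 := (mem_iff_conjugate_notMem (Φ i₀) b).1 hΦb
  -- second slot: `d = τc`, `τ d = c̄`, `τ c̄ = d̄`, `τ d̄ = c`
  set d : K i₁ →+* ℂ := τ • c with hd
  have hτd : τ • d = conjugate c := hτc
  have hτc' : τ • conjugate c = conjugate d := by rw [QuarticCM.smul_conjugate]
  have hτd' : τ • conjugate d = c := by rw [QuarticCM.smul_conjugate, hτd, involutive_conjugate (K i₁) c]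
  have hdc : d ≠ c := by
    intro h
    have h2 : τ • τ • c = c := by rw [← hd, h, ← hd, h]
    exact QuarticCM.conjugate_ne c (hτc.symm.trans h2)
  have hdc' : d ≠ conjugate c := by
    intro h
    have h1 : τ • conjugate c = conjugate c := by rwa [h] at hτd
    have h2 : τ • c = c := by
      have := congrArg conjugate h1
      rwa [QuarticCM.smul_conjugate, involutive_conjugate (K i₁) (τ • c), involutive_conjugate (K i₁) c] at this
    exact hdc (hd.trans h2)
  have hΦc : c ∈ (Φ i₁).1 := (hΦ₁ c).2 (Or.inl rfl); have hΦd : d ∈ (Φ i₁).1 := (hΦ₁ d).2 (Or.inr rfl)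
  have hΦnc : conjugate c ∉ (Φ i₁).1 := (mem_iff_conjugate_notMem (Φ i₁) c).1 hΦc
  have hΦnd : conjugate d ∉ (Φ i₁).1 := (mem_iff_conjugate_notMem (Φ i₁) d).1 hΦd
  -- `τ³ c = d̄`, `τ³ d = c`, and the relation `τ₀ d = τ³ (τ₀ c)`
  have hτ3c : τ • τ • τ • c = conjugate d := by rw [← hd, hτd, hτc']
  rw [CMAlgebra.isNondegenerateFamily_iff_forall_nat_symm]
  intro f hf
  -- the balance identity, evaluated
  have hsum : ∀ g : ℂ ≃+* ℂ,
      ∑ x : (i : I) × (K i →+* ℂ), (f x : ℚ) * translateInd (CMAlgebra.familyType Φ) g x =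
        (f ⟨i₀, a⟩ : ℚ) * translateInd (Φ i₀).1 g a + f ⟨i₀, conjugate a⟩ * translateInd (Φ i₀).1 g (conjugate a) +
          f ⟨i₀, b⟩ * translateInd (Φ i₀).1 g b + f ⟨i₀, conjugate b⟩ * translateInd (Φ i₀).1 g (conjugate b) +
        ((f ⟨i₁, c⟩ : ℚ) * translateInd (Φ i₁).1 g c + f ⟨i₁, conjugate c⟩ * translateInd (Φ i₁).1 g (conjugate c) +
          f ⟨i₁, d⟩ * translateInd (Φ i₁).1 g d + f ⟨i₁, conjugate d⟩ * translateInd (Φ i₁).1 g (conjugate d)) :=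
    fun g => by
    rw [Fintype.sum_sigma, sum_eq_add_two h01 hI, QuarticCM.sum_eq_add_four h4₀ hba hba',
      QuarticCM.sum_eq_add_four h4₁ hdc hdc']
    simp only [CMAlgebra.translateInd_familyType]
  have htot : ∑ x : (i : I) × (K i →+* ℂ), (f x : ℚ) =
      (f ⟨i₀, a⟩ : ℚ) + f ⟨i₀, conjugate a⟩ + f ⟨i₀, b⟩ + f ⟨i₀, conjugate b⟩ +
        ((f ⟨i₁, c⟩ : ℚ) + f ⟨i₁, conjugate c⟩ + f ⟨i₁, d⟩ + f ⟨i₁, conjugate d⟩) := by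
    rw [Fintype.sum_sigma, sum_eq_add_two h01 hI, QuarticCM.sum_eq_add_four h4₀ hba hba',
      QuarticCM.sum_eq_add_four h4₁ hdc hdc']
  have E1 := hf 1; have E2 := hf τ; have E3 := hf (τ * τ); have E4 := hf (τ * τ * τ)
  have E5 := hf τ₀; have E6 := hf (τ₀ * τ); have E7 := hf (τ₀ * (τ * τ)); have E8 := hf (τ₀ * (τ * τ * τ))
  rw [hsum, htot] at E1 E2 E3 E4 E5 E6 E7 E8
  -- conclude in the two cases for `τ₀ c`
  have key : (f ⟨i₀, conjugate a⟩ : ℚ) = f ⟨i₀, a⟩ ∧ (f ⟨i₀, conjugate b⟩ : ℚ) = f ⟨i₀, b⟩ ∧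
      (f ⟨i₁, conjugate c⟩ : ℚ) = f ⟨i₁, c⟩ ∧ (f ⟨i₁, conjugate d⟩ : ℚ) = f ⟨i₁, d⟩ := by
    rcases hτ₀c with h0 | h0
    · -- `τ₀ c = d̄`, `τ₀ d = c̄`, `τ₀ c̄ = d`, `τ₀ d̄ = c`
      have hτ₀c' : τ₀ • c = conjugate d := h0.trans hτ3c
      have hτ₀d : τ₀ • d = conjugate c := by rw [hd, hτ₀τc, hτ₀c', hτd', ← hd, hτd]
      have hτ₀cc : τ₀ • conjugate c = d := by rw [QuarticCM.smul_conjugate, hτ₀c', involutive_conjugate (K i₁) d]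
      have hτ₀dd : τ₀ • conjugate d = c := by rw [QuarticCM.smul_conjugate, hτ₀d, involutive_conjugate (K i₁) c]
      simp only [translateInd, one_smul, mul_smul, hτa, hτa', hτb, hτb', hτ₀a, hτ₀a', hτ₀b, hτ₀b', ← hd, hτd, hτc',
        hτd', hτ₀c', hτ₀d, hτ₀cc, hτ₀dd, hΦa, hΦb, hΦna, hΦnb, hΦc, hΦd, hΦnc, hΦnd,
        if_true, if_false, mul_one, mul_zero, add_zero, zero_add] at E1 E2 E3 E4 E5 E6 E7 E8
      refine ⟨?_, ?_, ?_, ?_⟩ <;> linarith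
    · -- `τ₀ c = d`, `τ₀ d = c`, `τ₀ c̄ = d̄`, `τ₀ d̄ = c̄`
      have hτ₀c' : τ₀ • c = d := h0.trans hd.symm
      have hτ₀d : τ₀ • d = c := by rw [hd, hτ₀τc, hτ₀c', hd, hτc, hτc', hτd']
      have hτ₀cc : τ₀ • conjugate c = conjugate d := by rw [QuarticCM.smul_conjugate, hτ₀c']
      have hτ₀dd : τ₀ • conjugate d = conjugate c := by rw [QuarticCM.smul_conjugate, hτ₀d]
      simp only [translateInd, one_smul, mul_smul, hτa, hτa', hτb, hτb', hτ₀a, hτ₀a', hτ₀b, hτ₀b', ← hd, hτd, hτc',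
        hτd', hτ₀c', hτ₀d, hτ₀cc, hτ₀dd, hΦa, hΦb, hΦna, hΦnb, hΦc, hΦd, hΦnc, hΦnd,
        if_true, if_false, mul_one, mul_zero, add_zero, zero_add] at E1 E2 E3 E4 E5 E6 E7 E8
      refine ⟨?_, ?_, ?_, ?_⟩ <;> linarith
  obtain ⟨ka, kb, kc, kd⟩ := key
  rintro ⟨i, s⟩
  change f ⟨i, conjugate s⟩ = f ⟨i, s⟩
  rcases hI i with rfl | rfl
  · rcases QuarticCM.eq_or_eq_or_eq_or_eq h4₀ hba hba' s with rfl | rfl | rfl | rfl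
    · exact_mod_cast ka
    · rw [involutive_conjugate (K i) a]; exact_mod_cast ka.symm
    · exact_mod_cast kb
    · rw [involutive_conjugate (K i) b]; exact_mod_cast kb.symm
  · rcases QuarticCM.eq_or_eq_or_eq_or_eq h4₁ hdc hdc' s with rfl | rfl | rfl | rfl
    · exact_mod_cast kc
    · rw [involutive_conjugate (K i) c]; exact_mod_cast kc.symm
    · exact_mod_cast kd
    · rw [involutive_conjugate (K i) d]; exact_mod_cast kd.symm

end Core

/-! ### A non-Galois quartic CM field and a non-isomorphic partner in the same closure -/
section Dress

variable {I : Type} {K : I → Type} [∀ i, Field (K i)] [∀ i, NumberField (K i)] [∀ i, IsCMField (K i)] [Fintype I]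

omit [∀ i, IsCMField (K i)] [Fintype I] in
/-- Two automorphisms of `ℂ` agreeing on every embedding of `K_{i₀}` agree on every embedding of a field `K_{i₁}` all
of whose embeddings take values in `L_{i₀}`. [cite: MoonenZarhin1999LowDim, "Hodge groups of simple abelian surfaces of CM-type"] -/
private theorem smul_eq_smul_of_forall_smul_eq {i₀ i₁ : I} {σ σ' : ℂ ≃+* ℂ}
    (h : ∀ s : K i₀ →+* ℂ, σ • s = σ' • s)
    (hL : ∀ (s' : K i₁ →+* ℂ) (x : K i₁), s' x ∈ normalClosure ℚ (K i₀) ℂ) (s' : K i₁ →+* ℂ) :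
    σ • s' = σ' • s' :=
  RingHom.ext fun x => apply_eq_of_forall_smul_eq i₀ h (hL s' x)

omit [Fintype I] in
/-- A subfield of a finite extension (inside `ℂ`) is finite. [cite: MoonenZarhin1999LowDim, "Hodge groups of simple abelian surfaces of CM-type"] -/
private theorem finiteDimensional_of_le₉ {E E' : IntermediateField ℚ ℂ} [FiniteDimensional ℚ E] (h : E' ≤ E) :
    FiniteDimensional ℚ E' :=
  FiniteDimensional.of_injective (IntermediateField.inclusion h).toLinearMap (IntermediateField.inclusion_injective h)

omit [Fintype I] in
/-- If `σ ∈ Aut(ℂ)` fixes an embedding `s` of the non-Galois quartic CM field `K_{i₀}` but moves another, and fixes an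
embedding `c` of a quartic `K_{i₁}` valued in `L_{i₀}`, then `K_{i₀} ≅ K_{i₁}`: `s(K_{i₀}) = L_{i₀} ∩ Fix(σ) = c(K_{i₁})`
(degree `4` inside the octic `L_{i₀}`). [cite: Shimura1998, §8.4 Example (2)(C)] -/
private theorem nonempty_ringEquiv_of_smul_eq_self {i₀ i₁ : I} (h4₀ : finrank ℚ (K i₀) = 4)
    (hK₀ : ¬ IsGalois ℚ (K i₀)) (h4₁ : finrank ℚ (K i₁) = 4) {σ : ℂ ≃+* ℂ} {s s₂ : K i₀ →+* ℂ} (hs : σ • s = s)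
    (hs₂ : σ • s₂ ≠ s₂) {c : K i₁ →+* ℂ} (hc : σ • c = c)
    (hL : ∀ (s' : K i₁ →+* ℂ) (x : K i₁), s' x ∈ normalClosure ℚ (K i₀) ℂ) : Nonempty (K i₀ ≃+* K i₁) := by
  -- the fixed field of `σ` inside `L₀`
  let Fixσ : IntermediateField ℚ ℂ :=
    (RingHom.eqLocusField σ.toRingHom (RingHom.id ℂ)).toIntermediateField fun q => by
      rw [RingHom.mem_eqLocusField, RingHom.id_apply, eq_ratCast, RingEquiv.toRingHom_eq_coe, RingEquiv.coe_toRingHom,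
        map_ratCast]
  let F : IntermediateField ℚ ℂ := normalClosure ℚ (K i₀) ℂ ⊓ Fixσ
  haveI : FiniteDimensional ℚ ↥F := finiteDimensional_of_le₉ inf_le_left
  have hsF : s.toRatAlgHom.fieldRange ≤ F := by
    rintro _ ⟨x, rfl⟩
    refine IntermediateField.mem_inf.2 ⟨apply_mem_normalClosure i₀ s x, ?_⟩
    change σ.toRingHom (s x) = RingHom.id ℂ (s x)
    rw [RingHom.id_apply, RingEquiv.toRingHom_eq_coe, RingEquiv.coe_toRingHom]
    exact RingHom.congr_fun hs x
  have hcF : c.toRatAlgHom.fieldRange ≤ F := by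
    rintro _ ⟨x, rfl⟩
    refine IntermediateField.mem_inf.2 ⟨hL c x, ?_⟩
    change σ.toRingHom (c x) = RingHom.id ℂ (c x)
    rw [RingHom.id_apply, RingEquiv.toRingHom_eq_coe, RingEquiv.coe_toRingHom]
    exact RingHom.congr_fun hc x
  have hFne : F ≠ normalClosure ℚ (K i₀) ℂ := by
    intro hF
    apply hs₂
    refine RingHom.ext fun x => ?_
    have hx : s₂ x ∈ F := hF ▸ apply_mem_normalClosure i₀ s₂ x
    have hx' : σ.toRingHom (s₂ x) = RingHom.id ℂ (s₂ x) := (IntermediateField.mem_inf.1 hx).2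
    rw [RingHom.id_apply, RingEquiv.toRingHom_eq_coe, RingEquiv.coe_toRingHom] at hx'
    exact hx'
  -- degrees: `4 ∣ [F : ℚ] ∣ 8`, `[F : ℚ] ≠ 8`, so `[F : ℚ] = 4 = [s(K₀) : ℚ] = [c(K₁) : ℚ]`
  have h8 : finrank ℚ ↥(normalClosure ℚ (K i₀) ℂ) = 8 := finrank_normalClosure_complex_eq_eight i₀ h4₀ hK₀
  have hF8 : finrank ℚ ↥F ∣ 8 := h8 ▸ IntermediateField.finrank_dvd_of_le_right inf_le_left
  have h4s : finrank ℚ ↥s.toRatAlgHom.fieldRange = 4 := by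
    rw [← h4₀]; exact (AlgEquiv.ofInjectiveField s.toRatAlgHom).toLinearEquiv.finrank_eq.symm
  have h4c : finrank ℚ ↥c.toRatAlgHom.fieldRange = 4 := by
    rw [← h4₁]; exact (AlgEquiv.ofInjectiveField c.toRatAlgHom).toLinearEquiv.finrank_eq.symm
  have h4F : 4 ∣ finrank ℚ ↥F := h4s ▸ IntermediateField.finrank_dvd_of_le_right hsF
  have hFne8 : finrank ℚ ↥F ≠ 8 := fun h => hFne (IntermediateField.eq_of_le_of_finrank_eq inf_le_left (by rw [h, h8]))
  have hF4 : finrank ℚ ↥F = 4 := by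
    obtain ⟨k, hk⟩ := h4F
    have hk2 : k ∣ 2 := by
      have : 4 * k ∣ 4 * 2 := by rw [← hk]; exact hF8
      exact Nat.dvd_of_mul_dvd_mul_left (by norm_num) this
    rcases (Nat.dvd_prime Nat.prime_two).1 hk2 with rfl | rfl
    · rw [hk]
    · exact absurd (by rw [hk]) hFne8
  have hsF' : s.toRatAlgHom.fieldRange = F := IntermediateField.eq_of_le_of_finrank_eq hsF (by rw [h4s, hF4])
  have hcF' : c.toRatAlgHom.fieldRange = F := IntermediateField.eq_of_le_of_finrank_eq hcF (by rw [h4c, hF4])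
  exact ⟨((AlgEquiv.ofInjectiveField s.toRatAlgHom).trans
    ((IntermediateField.equivOfEq (hsF'.trans hcF'.symm)).trans (AlgEquiv.ofInjectiveField c.toRatAlgHom).symm)).toRingEquiv⟩

/-- **A non-Galois quartic CM field and a non-isomorphic quartic CM field with the same Galois closure: every pair of
CM types is a NONDEGENERATE family** (a simple CM surface and one with CM by the reflex field): the reflection `τ₀`
fixing `a(K_{i₀})` acts without fixed points on `Hom(K_{i₁}, ℂ)`, and the eight balance identities apply.
[cite: MoonenZarhin1999LowDim, "Hodge groups of simple abelian surfaces of CM-type"] [cite: Shimura1998, §8.4 Example (2)(C)] -/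
theorem isNondegenerateFamily_pair_of_same_closure_of_isEmpty {i₀ i₁ : I} (h01 : i₀ ≠ i₁)
    (hI : ∀ j, j = i₀ ∨ j = i₁) (h4₀ : finrank ℚ (K i₀) = 4) (hK₀ : ¬ IsGalois ℚ (K i₀))
    (h4₁ : finrank ℚ (K i₁) = 4) (hL : ∀ (s' : K i₁ →+* ℂ) (x : K i₁), s' x ∈ normalClosure ℚ (K i₀) ℂ)
    (hKK : IsEmpty (K i₀ ≃+* K i₁)) (Φ : ∀ i, CMType (K i)) : CMAlgebra.IsNondegenerateFamily Φ := by
  -- slot `i₀`: the type `{a, b}`, the `4`-cycle `τ` and the reflection `τ₀`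
  obtain ⟨a, b, hba, hba', hΦ₀⟩ := QuarticCM.exists_mem_mem_ne h4₀ (Φ i₀)
  obtain ⟨τ, hτa, hτb⟩ := QuarticCM.exists_ringAut_smul_eq_smul_eq_conjugate h4₀ hK₀ hba hba'
  obtain ⟨τ₀, hτ₀a, hτ₀b⟩ := QuarticCM.exists_ringAut_smul_eq_self_smul_eq_conjugate_of_not_isGalois h4₀ hK₀ hba hba'
  have hτa' : τ • conjugate a = conjugate b := by rw [QuarticCM.smul_conjugate, hτa]
  have hτb' : τ • conjugate b = a := by rw [QuarticCM.smul_conjugate, hτb, involutive_conjugate (K i₀) a]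
  have hτ₀a' : τ₀ • conjugate a = conjugate a := by rw [QuarticCM.smul_conjugate, hτ₀a]
  have hτ₀b' : τ₀ • conjugate b = b := by rw [QuarticCM.smul_conjugate, hτ₀b, involutive_conjugate (K i₀) b]
  -- relations on the embeddings of `K_{i₀}`: `τ² = conj`, `τ₀τ = τ³τ₀`
  have h1 : ∀ s : K i₀ →+* ℂ, (τ * τ) • s = (starRingAut : ℂ ≃+* ℂ) • s := by
    intro s
    rw [mul_smul, conj_smul_eq_conjugate]
    rcases QuarticCM.eq_or_eq_or_eq_or_eq h4₀ hba hba' s with rfl | rfl | rfl | rfl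
    · rw [hτa, hτb]
    · rw [hτa', hτb', involutive_conjugate (K i₀) a]
    · rw [hτb, hτa']
    · rw [hτb', hτa, involutive_conjugate (K i₀) b]
  have h2 : ∀ s : K i₀ →+* ℂ, (τ₀ * τ) • s = (τ * τ * τ * τ₀) • s := by
    intro s
    simp only [mul_smul]
    rcases QuarticCM.eq_or_eq_or_eq_or_eq h4₀ hba hba' s with rfl | rfl | rfl | rfl
    · rw [hτa, hτ₀b, hτ₀a, hτa, hτb, hτa']
    · rw [hτa', hτ₀b', hτ₀a', hτa', hτb', hτa]
    · rw [hτb, hτ₀a', hτ₀b, hτb', hτa, hτb]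
    · rw [hτb', hτ₀a, hτ₀b', hτb, hτa', hτb']
  -- transferred to the embeddings of `K_{i₁}` (valued in `L₀`)
  have g1 : ∀ s' : K i₁ →+* ℂ, τ • τ • s' = conjugate s' := fun s' => by
    have h := smul_eq_smul_of_forall_smul_eq h1 hL s'
    rwa [mul_smul, conj_smul_eq_conjugate] at h
  have g2 : ∀ s' : K i₁ →+* ℂ, τ₀ • τ • s' = τ • τ • τ • τ₀ • s' := fun s' => by
    have h := smul_eq_smul_of_forall_smul_eq h2 hL s'
    simpa only [mul_smul] using h
  -- slot `i₁`: write the type as `{c, τc}`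
  obtain ⟨c', d', hdc, hdc', hΦ₁'⟩ := QuarticCM.exists_mem_mem_ne h4₁ (Φ i₁)
  have hc : ∃ c : K i₁ →+* ℂ, ∀ s, s ∈ (Φ i₁).1 ↔ s = c ∨ s = τ • c := by
    rcases QuarticCM.eq_or_eq_or_eq_or_eq h4₁ hdc hdc' (τ • c') with h | h | h | h
    · exfalso
      have h2' : τ • τ • c' = c' := by rw [h, h]
      exact QuarticCM.conjugate_ne c' ((g1 c').symm.trans h2')
    · exfalso
      have h2' : τ • τ • c' = c' := by
        rw [h, QuarticCM.smul_conjugate, h, involutive_conjugate (K i₁) c']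
      exact QuarticCM.conjugate_ne c' ((g1 c').symm.trans h2')
    · exact ⟨c', fun s => by rw [hΦ₁' s, h]⟩
    · have hτd' : τ • d' = c' := by
        have h2' : τ • τ • c' = conjugate (τ • d') := by rw [h, QuarticCM.smul_conjugate]
        exact ((involutive_conjugate (K i₁)).injective ((g1 c').symm.trans h2')).symm
      exact ⟨d', fun s => by rw [hΦ₁' s, hτd']; tauto⟩
  obtain ⟨c, hΦ₁⟩ := hc
  have hτc : τ • τ • c = conjugate c := g1 c
  have hdc1 : τ • c ≠ c := by
    intro h
    have h2' : τ • τ • c = c := by rw [h, h]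
    exact QuarticCM.conjugate_ne c (hτc.symm.trans h2')
  have hdc1' : τ • c ≠ conjugate c := by
    intro h
    have h2' : τ • τ • c = c := by rw [h, QuarticCM.smul_conjugate, h, involutive_conjugate (K i₁) c]
    exact QuarticCM.conjugate_ne c (hτc.symm.trans h2')
  -- `τ₀ c ∈ {c, c̄, τc, τ³c}`; the first two would make `K_{i₁} ≅ K_{i₀}`
  rcases QuarticCM.eq_or_eq_or_eq_or_eq h4₁ hdc1 hdc1' (τ₀ • c) with h | h | h | h
  · have hτ₀b'' : τ₀ • b ≠ b := by rw [hτ₀b]; exact QuarticCM.conjugate_ne b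
    exact (hKK.false (Classical.choice (nonempty_ringEquiv_of_smul_eq_self h4₀ hK₀ h4₁ hτ₀a hτ₀b'' h hL))).elim
  · -- `σ = τ²τ₀` fixes `b` and `c`, moves `a`
    have hσb : (τ * τ * τ₀) • b = b := by rw [mul_smul, mul_smul, hτ₀b, hτb', hτa]
    have hσa : (τ * τ * τ₀) • a ≠ a := by rw [mul_smul, mul_smul, hτ₀a, hτa, hτb]; exact QuarticCM.conjugate_ne a
    have hσc : (τ * τ * τ₀) • c = c := by
      rw [mul_smul, mul_smul, h, QuarticCM.smul_conjugate, QuarticCM.smul_conjugate, hτc,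
        involutive_conjugate (K i₁) c]
    exact (hKK.false (Classical.choice (nonempty_ringEquiv_of_smul_eq_self h4₀ hK₀ h4₁ hσb hσa hσc hL))).elim
  · exact isNondegenerateFamily_pair_of_reflection_free h01 hI h4₀ h4₁ hba hba' hτa hτb hτ₀a hτ₀b hτc (g2 c)
      (Or.inr h) hΦ₀ hΦ₁
  · exact isNondegenerateFamily_pair_of_reflection_free h01 hI h4₀ h4₁ hba hba' hτa hτb hτ₀a hτ₀b hτc (g2 c)
      (Or.inl (h.trans (g1 (τ • c)).symm)) hΦ₀ hΦ₁

/-- **Non-isomorphic quartic CM fields with `L₀ = L₁`: every pair of types is nondegenerate** (a Galois `K_{i₀}` is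
excluded: `L₀ = ι(K_{i₀})` would be the image of `K_{i₁}`). [cite: MoonenZarhin1999LowDim, "Hodge groups of simple abelian surfaces of CM-type"] -/
theorem isNondegenerateFamily_pair_of_normalClosure_eq_of_isEmpty {i₀ i₁ : I} (h01 : i₀ ≠ i₁)
    (hI : ∀ j, j = i₀ ∨ j = i₁) (h4₀ : finrank ℚ (K i₀) = 4) (h4₁ : finrank ℚ (K i₁) = 4)
    (hL : normalClosure ℚ (K i₀) ℂ = normalClosure ℚ (K i₁) ℂ) (hKK : IsEmpty (K i₀ ≃+* K i₁))
    (Φ : ∀ i, CMType (K i)) : CMAlgebra.IsNondegenerateFamily Φ := by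
  have hL' : ∀ (s' : K i₁ →+* ℂ) (x : K i₁), s' x ∈ normalClosure ℚ (K i₀) ℂ := fun s' x =>
    hL ▸ apply_mem_normalClosure i₁ s' x
  by_cases hK₀ : IsGalois ℚ (K i₀)
  · -- `L₀ = s₀(K₀)` has degree `4` and contains `s₁(K₁)` of degree `4`: the fields are isomorphic
    exfalso
    obtain ⟨s₀⟩ : Nonempty (K i₀ →+* ℂ) := inferInstance
    obtain ⟨s₁⟩ : Nonempty (K i₁ →+* ℂ) := inferInstance
    have hle : s₁.toRatAlgHom.fieldRange ≤ s₀.toRatAlgHom.fieldRange := by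
      rw [← normalClosure_eq_fieldRange_of_normal s₀.toRatAlgHom]
      rintro _ ⟨x, rfl⟩
      exact hL' s₁ x
    haveI : FiniteDimensional ℚ ↥s₀.toRatAlgHom.fieldRange :=
      finiteDimensional_of_le₉ (AlgHom.fieldRange_le_normalClosure s₀.toRatAlgHom)
    have h4s₀ : finrank ℚ ↥s₀.toRatAlgHom.fieldRange = 4 := by
      rw [← h4₀]; exact (AlgEquiv.ofInjectiveField s₀.toRatAlgHom).toLinearEquiv.finrank_eq.symm
    have h4s₁ : finrank ℚ ↥s₁.toRatAlgHom.fieldRange = 4 := by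
      rw [← h4₁]; exact (AlgEquiv.ofInjectiveField s₁.toRatAlgHom).toLinearEquiv.finrank_eq.symm
    have heq : s₁.toRatAlgHom.fieldRange = s₀.toRatAlgHom.fieldRange :=
      IntermediateField.eq_of_le_of_finrank_eq hle (by rw [h4s₀, h4s₁])
    exact hKK.false ((AlgEquiv.ofInjectiveField s₀.toRatAlgHom).trans
      ((IntermediateField.equivOfEq heq.symm).trans (AlgEquiv.ofInjectiveField s₁.toRatAlgHom).symm)).toRingEquiv
  · exact isNondegenerateFamily_pair_of_same_closure_of_isEmpty h01 hI h4₀ hK₀ h4₁ hL' hKK Φ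

end Dress

end Literature.AlgebraicGeometry.ComplexMultiplication

end

/-! ## Part 2: SimpleCMSurfacePairsHodge -/

noncomputable section

open _root_.CategoryTheory _root_.CategoryTheory.Limits NumberField NumberField.ComplexEmbedding IntermediateField Module

namespace Literature.AlgebraicGeometry.ComplexMultiplication

open Literature.AlgebraicGeometry.ComplexMultiplication.RankClosureBound Literature.AlgebraicGeometry.ComplexMultiplication.Domination Literature.AlgebraicGeometry.ComplexMultiplication.SmallIntersectionCMFieldsHodge

open Literature.NumberTheory.ComplexMultiplication
open Literature.AlgebraicGeometry.Motives (AbelianVariety CMType)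
open Literature.AlgebraicGeometry.HodgeTheory
open Literature.AlgebraicGeometry.Pohlmann1968

/-! ### Proper normal subfields of the Galois closure of a quartic CM field are totally real -/

section Fields

variable {I : Type} {K : I → Type} [∀ i, Field (K i)] [∀ i, NumberField (K i)] [∀ i, IsCMField (K i)]

/-- A subfield of a finite extension (inside `ℂ`) is finite. [cite: Shimura1998, §8.4 Example (2)] -/
private theorem finiteDimensional_of_le₈ {E E' : IntermediateField ℚ ℂ} [FiniteDimensional ℚ E] (h : E' ≤ E) :
    FiniteDimensional ℚ E' :=
  FiniteDimensional.of_injective (IntermediateField.inclusion h).toLinearMap (IntermediateField.inclusion_injective h)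

/-- An automorphism of `ℂ` fixes `ℚ`. [cite: Shimura1998, §8.4 Example (2)] -/
private theorem ringEquiv_apply_algebraMap₈ (g : ℂ ≃+* ℂ) (q : ℚ) : g (algebraMap ℚ ℂ q) = algebraMap ℚ ℂ q := by
  rw [eq_ratCast]
  exact map_ratCast g q

/-- **Non-Galois quartic CM field: every normal `M ⊊ L` is fixed pointwise by conjugation.**  On the four embeddings
`a, ā, b, b̄` the `4`-cycle `τ` and the reflection `τ₀` of `Aut(ℂ)` satisfy `τ² = conj`, `τ₀² = 1`, `(τ₀τ)² = 1` on `L`;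
in the commutative group `Gal(M/ℚ)` (order `1`, `2` or `4`) this forces `conj|_M = τ²|_M = τ₀²τ²|_M = (τ₀τ)²|_M = 1`.
[cite: Shimura1998, §8.4 Example (2)(C)] [cite: Lang2002, I §6] -/
theorem conj_apply_eq_of_ne_normalClosure_of_not_isGalois (i : I) (h4 : finrank ℚ (K i) = 4)
    (hK : ¬ IsGalois ℚ (K i)) (M : IntermediateField ℚ ℂ) [FiniteDimensional ℚ M]
    [@Normal ℚ M _ _ (IntermediateField.algebra' M)] (hM : M ≤ normalClosure ℚ (K i) ℂ)
    (hne : M ≠ normalClosure ℚ (K i) ℂ) {x : ℂ} (hx : x ∈ M) : starRingEnd ℂ x = x := by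
  letI iM : Algebra ℚ ↥M := IntermediateField.algebra' M
  haveI : Algebra.IsSeparable ℚ ↥M := Algebra.IsAlgebraic.isSeparable_of_perfectField
  haveI : IsGalois ℚ ↥M := ⟨⟩
  -- the four embeddings and the dihedral generators inside `Aut(ℂ)`
  obtain ⟨a⟩ : Nonempty (K i →+* ℂ) := inferInstance
  obtain ⟨b, hba, hba'⟩ := QuarticCM.exists_ne_ne_conjugate h4 a
  obtain ⟨τ, hτa, hτb⟩ := QuarticCM.exists_ringAut_smul_eq_smul_eq_conjugate h4 hK hba hba'
  obtain ⟨τ₀, hτ₀a, hτ₀b⟩ := QuarticCM.exists_ringAut_smul_eq_self_smul_eq_conjugate_of_not_isGalois h4 hK hba hba'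
  have hτa' : τ • conjugate a = conjugate b := by rw [QuarticCM.smul_conjugate, hτa]
  have hτb' : τ • conjugate b = a := by rw [QuarticCM.smul_conjugate, hτb, involutive_conjugate (K i) a]
  have hτ₀a' : τ₀ • conjugate a = conjugate a := by rw [QuarticCM.smul_conjugate, hτ₀a]
  have hτ₀b' : τ₀ • conjugate b = b := by rw [QuarticCM.smul_conjugate, hτ₀b, involutive_conjugate (K i) b]
  -- the relations, checked on `a, ā, b, b̄`
  have h1 : ∀ s : K i →+* ℂ, (τ * τ) • s = (starRingAut : ℂ ≃+* ℂ) • s := by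
    intro s
    rw [mul_smul, conj_smul_eq_conjugate]
    rcases QuarticCM.eq_or_eq_or_eq_or_eq h4 hba hba' s with rfl | rfl | rfl | rfl
    · rw [hτa, hτb]
    · rw [hτa', hτb', involutive_conjugate (K i) a]
    · rw [hτb, hτa']
    · rw [hτb', hτa, involutive_conjugate (K i) b]
  have h2 : ∀ s : K i →+* ℂ, (τ₀ * τ * (τ₀ * τ)) • s = (1 : ℂ ≃+* ℂ) • s := by
    intro s
    rw [one_smul, mul_smul, mul_smul, mul_smul]
    rcases QuarticCM.eq_or_eq_or_eq_or_eq h4 hba hba' s with rfl | rfl | rfl | rfl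
    · rw [hτa, hτ₀b, hτb', hτ₀a]
    · rw [hτa', hτ₀b', hτb, hτ₀a']
    · rw [hτb, hτ₀a', hτa', hτ₀b']
    · rw [hτb', hτ₀a, hτa, hτ₀b]
  have h3 : ∀ s : K i →+* ℂ, (τ₀ * τ₀) • s = (1 : ℂ ≃+* ℂ) • s := by
    intro s
    rw [one_smul, mul_smul]
    rcases QuarticCM.eq_or_eq_or_eq_or_eq h4 hba hba' s with rfl | rfl | rfl | rfl
    · rw [hτ₀a, hτ₀a]
    · rw [hτ₀a', hτ₀a']
    · rw [hτ₀b, hτ₀b']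
    · rw [hτ₀b', hτ₀b]
  -- hence on `L`, hence on `M ≤ L`
  have hL1 : ∀ y : ℂ, y ∈ M → τ (τ y) = starRingEnd ℂ y := fun y hy => by
    have h := apply_eq_of_forall_smul_eq i h1 (hM hy)
    rwa [RingAut.mul_apply, starRingAut_apply, ← starRingEnd_apply] at h
  have hL2 : ∀ y : ℂ, y ∈ M → τ₀ (τ (τ₀ (τ y))) = y := fun y hy => by
    have h := apply_eq_of_forall_smul_eq i h2 (hM hy)
    rwa [RingAut.mul_apply, RingAut.mul_apply, RingAut.mul_apply, RingAut.one_apply] at h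
  have hL3 : ∀ y : ℂ, y ∈ M → τ₀ (τ₀ y) = y := fun y hy => by
    have h := apply_eq_of_forall_smul_eq i h3 (hM hy)
    rwa [RingAut.mul_apply, RingAut.one_apply] at h
  -- degrees: `[M : ℚ] ∣ 8`, `≠ 8`
  have h8 : finrank ℚ ↥(normalClosure ℚ (K i) ℂ) = 8 := finrank_normalClosure_complex_eq_eight i h4 hK
  have hdvd : finrank ℚ ↥M ∣ 8 := h8 ▸ IntermediateField.finrank_dvd_of_le_right hM
  have hne8 : finrank ℚ ↥M ≠ 8 := fun h => hne (IntermediateField.eq_of_le_of_finrank_eq hM (by rw [h, h8]))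
  by_cases h4M : finrank ℚ ↥M = 4
  · -- `Gal(M/ℚ)` has order `2²`: commutative
    let τQ : ℂ ≃ₐ[ℚ] ℂ := AlgEquiv.ofRingEquiv (f := τ) (ringEquiv_apply_algebraMap₈ _)
    let τ₀Q : ℂ ≃ₐ[ℚ] ℂ := AlgEquiv.ofRingEquiv (f := τ₀) (ringEquiv_apply_algebraMap₈ _)
    let T : (↥M) ≃ₐ[ℚ] ↥M := τQ.restrictNormal _
    let T₀ : (↥M) ≃ₐ[ℚ] ↥M := τ₀Q.restrictNormal _
    have hT : ∀ y : ↥M, ((T y : ↥M) : ℂ) = τ y := fun y => AlgEquiv.restrictNormal_commutes τQ _ y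
    have hT₀ : ∀ y : ↥M, ((T₀ y : ↥M) : ℂ) = τ₀ y := fun y => AlgEquiv.restrictNormal_commutes τ₀Q _ y
    have hrel : T₀ * T * (T₀ * T) = 1 :=
      AlgEquiv.ext fun y => Subtype.ext (by
        rw [AlgEquiv.mul_apply, AlgEquiv.mul_apply, AlgEquiv.mul_apply, AlgEquiv.one_apply, hT₀, hT, hT₀, hT]
        exact hL2 y y.2)
    have hrel₀ : T₀ * T₀ = 1 :=
      AlgEquiv.ext fun y => Subtype.ext (by rw [AlgEquiv.mul_apply, AlgEquiv.one_apply, hT₀, hT₀]; exact hL3 y y.2)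
    haveI : Fact (Nat.Prime 2) := ⟨Nat.prime_two⟩
    have hcomm : IsMulCommutative ((↥M) ≃ₐ[ℚ] ↥M) :=
      IsPGroup.isMulCommutative_of_card_eq_prime_sq (p := 2) (by rw [IsGalois.card_aut_eq_finrank, h4M]; norm_num)
    have hTT : T * T = 1 := by
      have hc := hcomm.is_comm.comm T T₀
      -- `T₀ T T₀ T = T₀ T₀ T T = T T`
      rw [mul_assoc, ← mul_assoc T T₀ T, hc, mul_assoc, ← mul_assoc, hrel₀, one_mul] at hrel
      exact hrel
    have hy := congrArg (fun e : (↥M) ≃ₐ[ℚ] ↥M => ((e ⟨x, hx⟩ : ↥M) : ℂ)) hTT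
    simp only [AlgEquiv.mul_apply, AlgEquiv.one_apply, hT] at hy
    rw [← hL1 x hx]
    exact hy
  · -- `[M : ℚ] ∈ {1, 2}`: `4 ∤ [M : ℚ]`
    have hdvd' : finrank ℚ ↥M ∣ 2 ^ 3 := by norm_num; exact hdvd
    have h4n : ¬ 4 ∣ finrank ℚ ↥M := by
      intro h4d
      obtain ⟨k, hk, hkM⟩ := (Nat.dvd_prime_pow Nat.prime_two).1 hdvd'
      interval_cases k
      · rw [hkM] at h4d; norm_num at h4d
      · rw [hkM] at h4d; norm_num at h4d
      · exact h4M (by rw [hkM]; norm_num)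
      · exact hne8 (by rw [hkM]; norm_num)
    exact conj_apply_eq_of_apply_apply_eq_conj_of_not_dvd M τ hL1 h4n hx

/-- **Cyclic quartic CM field: every `M ⊊ L = ι(K)` is fixed pointwise by conjugation** (`[M : ℚ] ≤ 2` and conjugation
is a square in the cyclic group of order `4`). [cite: Shimura1998, §8.4 Example (2)(B)] -/
theorem conj_apply_eq_of_ne_normalClosure_of_isCyclic (i : I) [IsGalois ℚ (K i)] [IsCyclic (K i ≃ₐ[ℚ] K i)]
    (h4 : finrank ℚ (K i) = 4) (M : IntermediateField ℚ ℂ) [FiniteDimensional ℚ M] (hM : M ≤ normalClosure ℚ (K i) ℂ)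
    (hne : M ≠ normalClosure ℚ (K i) ℂ) {x : ℂ} (hx : x ∈ M) : starRingEnd ℂ x = x := by
  have hL : finrank ℚ ↥(normalClosure ℚ (K i) ℂ) = 4 := (finrank_normalClosure_of_normal (K := K i)).trans h4
  have hdvd : finrank ℚ ↥M ∣ 4 := hL ▸ IntermediateField.finrank_dvd_of_le_right hM
  have hne4 : finrank ℚ ↥M ≠ 4 := fun h => hne (IntermediateField.eq_of_le_of_finrank_eq hM (by rw [h, hL]))
  have hdvd' : finrank ℚ ↥M ∣ 2 ^ 2 := by norm_num; exact hdvd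
  have h2 : finrank ℚ ↥M ≤ 2 := by
    obtain ⟨k, hk, hkM⟩ := (Nat.dvd_prime_pow Nat.prime_two).1 hdvd'
    interval_cases k
    · rw [hkM]; norm_num
    · rw [hkM]; norm_num
    · exact absurd (by rw [hkM]; norm_num) hne4
  exact conj_apply_eq_of_isSquare_conjGal_of_finrank_le_two (isSquare_conjGal_of_isCyclic (by rw [h4])) M hM h2 hx

/-- **A quartic CM field which is not biquadratic: every normal `M ⊊ L` is fixed pointwise by conjugation** — the two
cases (cyclic Galois; non-Galois). [cite: Shimura1998, §8.4 Example (2) (B), (C)] -/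
theorem conj_apply_eq_of_ne_normalClosure_quartic (i : I) (h4 : finrank ℚ (K i) = 4)
    (hK : ¬ (IsGalois ℚ (K i) ∧ ¬ IsCyclic (K i ≃ₐ[ℚ] K i))) (M : IntermediateField ℚ ℂ) [FiniteDimensional ℚ M]
    [@Normal ℚ M _ _ (IntermediateField.algebra' M)] (hM : M ≤ normalClosure ℚ (K i) ℂ)
    (hne : M ≠ normalClosure ℚ (K i) ℂ) {x : ℂ} (hx : x ∈ M) : starRingEnd ℂ x = x := by
  by_cases hgal : IsGalois ℚ (K i)
  · have hcyc : IsCyclic (K i ≃ₐ[ℚ] K i) := by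
      by_contra hc
      exact hK ⟨hgal, hc⟩
    haveI := hgal
    haveI := hcyc
    exact conj_apply_eq_of_ne_normalClosure_of_isCyclic i h4 M hM hne hx
  · exact conj_apply_eq_of_ne_normalClosure_of_not_isGalois i h4 hgal M hM hne hx

/-- **Two quartic CM fields (not biquadratic) with DIFFERENT Galois closures: conjugation fixes `L₀ ∩ L₁` pointwise** —
`L₀ ∩ L₁` is normal and a proper subfield of `L₀` or of `L₁`. [cite: Shimura1998, §8.4 Example (2)] [cite: Lang2002, VI §1 Cor. 1.4] -/
theorem conj_apply_eq_of_mem_inf_of_normalClosure_ne {i₀ i₁ : I} (h4₀ : finrank ℚ (K i₀) = 4)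
    (h4₁ : finrank ℚ (K i₁) = 4) (hK₀ : ¬ (IsGalois ℚ (K i₀) ∧ ¬ IsCyclic (K i₀ ≃ₐ[ℚ] K i₀)))
    (hK₁ : ¬ (IsGalois ℚ (K i₁) ∧ ¬ IsCyclic (K i₁ ≃ₐ[ℚ] K i₁)))
    (hne : normalClosure ℚ (K i₀) ℂ ≠ normalClosure ℚ (K i₁) ℂ) {x : ℂ} (h₀ : x ∈ normalClosure ℚ (K i₀) ℂ)
    (h₁ : x ∈ normalClosure ℚ (K i₁) ℂ) : starRingEnd ℂ x = x := by
  haveI : ∀ j : I, @Normal ℚ ↥(normalClosure ℚ (K j) ℂ) _ _ (IntermediateField.algebra' _) :=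
    normal_normalClosure_complex
  letI : Algebra ℚ ↥(normalClosure ℚ (K i₀) ℂ ⊓ normalClosure ℚ (K i₁) ℂ) := IntermediateField.algebra' _
  haveI : FiniteDimensional ℚ ↥(normalClosure ℚ (K i₀) ℂ ⊓ normalClosure ℚ (K i₁) ℂ) :=
    finiteDimensional_of_le₈ inf_le_left
  have hx : x ∈ normalClosure ℚ (K i₀) ℂ ⊓ normalClosure ℚ (K i₁) ℂ := IntermediateField.mem_inf.2 ⟨h₀, h₁⟩
  by_cases hM₀ : normalClosure ℚ (K i₀) ℂ ⊓ normalClosure ℚ (K i₁) ℂ = normalClosure ℚ (K i₀) ℂ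
  · have hM₁ : normalClosure ℚ (K i₀) ℂ ⊓ normalClosure ℚ (K i₁) ℂ ≠ normalClosure ℚ (K i₁) ℂ :=
      fun h => hne (hM₀.symm.trans h)
    exact conj_apply_eq_of_ne_normalClosure_quartic i₁ h4₁ hK₁ _ inf_le_right hM₁ hx
  · exact conj_apply_eq_of_ne_normalClosure_quartic i₀ h4₀ hK₀ _ inf_le_left hM₀ hx

/-- A primitive CM type lives on a quartic CM field that is not biquadratic (Galois ⟹ cyclic).
[cite: Shimura1998, §8.4 Example (2)(A)] -/
theorem not_biquadratic_of_isPrimitive (i : I) (h4 : finrank ℚ (K i) = 4) {Φ : CMType (K i)} {φ₀ : K i →+* ℂ}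
    (hprim : IsPrimitive (ℂ ≃+* ℂ) Φ.1 φ₀) : ¬ (IsGalois ℚ (K i) ∧ ¬ IsCyclic (K i ≃ₐ[ℚ] K i)) := by
  rintro ⟨hgal, hc⟩
  haveI := hgal
  exact hc (QuarticCM.isCyclic_of_isPrimitive h4 hprim)

end Fields

/-! ### Abelian surfaces -/

section Geometry

variable {I : Type} {K : I → Type} [∀ i, Field (K i)] [∀ i, NumberField (K i)] [∀ i, IsCMField (K i)] [Fintype I]
  [Nonempty I] {Φ : ∀ i, CMType (K i)}
variable {A : I → AbelianVariety ℂ} {ι : ∀ i, 𝓞 (K i) →+* End (A i)}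
  {θ : ∀ i, K i →+* Module.End ℂ (complexBetti (A i).X 1)}

omit [Fintype I] [Nonempty I] in
/-- Every CM type of a quartic CM field that is not biquadratic is nondegenerate (all its types are primitive; Ribet's
bound in degree `≤ 6`). [cite: Shimura1998, §8.4 Example (2) (B), (C)] -/
theorem isNondegenerate_of_quartic_not_biquadratic (i : I) (h4 : finrank ℚ (K i) = 4)
    (hK : ¬ (IsGalois ℚ (K i) ∧ ¬ IsCyclic (K i ≃ₐ[ℚ] K i))) (Φ : CMType (K i)) : IsNondegenerate Φ := by
  by_cases hgal : IsGalois ℚ (K i)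
  · have hcyc : IsCyclic (K i ≃ₐ[ℚ] K i) := by
      by_contra hc
      exact hK ⟨hgal, hc⟩
    haveI := hgal
    haveI := hcyc
    exact isNondegenerate_of_isCyclic_of_finrank_eq_four h4 Φ
  · obtain ⟨φ₀⟩ : Nonempty (K i →+* ℂ) := inferInstance
    exact isNondegenerate_of_isPrimitive_of_finrank_le_six (Φ := Φ) (by omega) φ₀
      (isPrimitive_of_not_isGalois h4 hgal Φ φ₀)

end Geometry

end Literature.AlgebraicGeometry.ComplexMultiplication

end
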